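import Summits.FinalStateConjecture.FinalStateConjecture.Theorems.EIHFluxBalanceInertialRecessionChartCalculus
import Summits.FinalStateConjecture.FinalStateConjecture.Theorems.EIHFluxBalanceInertialRecessionLorentz
import Summits.FinalStateConjecture.FinalStateConjecture.Theorems.EIHFluxBalanceInertialRecessionSchwarzschildFrame
import Summits.FinalStateConjecture.FinalStateConjecture.Theorems.InertialRecession.Negative.PaintingRigidityStabiliser

/-!
# Route EIHFluxBalance — `InertialRecession`, re-charting: the spatial leg of a hole chart and the
# exact painted-radius identity

Helper file for the crux `stmt-FinalStateConjecture-10166`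
(`Summit.FinalStateConjecture.FinalStateConjecture.Theses.EIHFluxBalance.InertialRecession`),
line `sublinear-is-free-clean-window-charges`, stub `stub_rechart` (the transfer P2).

The hole chart of the transfer sends the rest-frame Kerr–Schild point `z = (τ, z̲)` of hole `i`
to the lab point `x = (T, ξᵢ(T)) + Λ̃ w`, where `Λ̃` is a frame with `Λ̃ e₀ = uᵢ(T)` (the painted
4-velocity) and `w` is the TIME-PURGED rest vector

  `w = (0, z̲) − ((Λ̃ (0, z̲))⁰ / (Λ̃ e₀)⁰) · e₀`,

chosen so that the lab displacement `Λ̃ w` is purely spatial (`(Λ̃ w)⁰ = 0`): the chart point has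
lab time exactly `T` and lab position `ξᵢ(T) + (Λ̃ w)~`. This file records the exact algebra of
that leg, for ONE frame `Λ̃ = Λ` (time dependence is irrelevant here):

* `purge_apply_zero`, `spatial_purge` — `(Λ w)⁰ = 0` and `w̃ = z̃`;
* `chartPoint_apply_zero`, `spatial_chartPoint` — lab time and lab position of `x`;
* `poincareInv_chartPoint` — the rest-frame position of `x` for the centre `(T, ξ)` and the frame
  `Λ` is `w` ITSELF, hence (`Kerr.radius`, `Kerr.bilin` depend on the spatial part only)
* `radius_poincareInv_chartPoint` — **the painted Kerr–Schild radius of the chart point is the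
  chart radius `r_a(z)` exactly**, also for the twisted painting frame `Λ·R_θ`
  (`radius_poincareInv_mul_rotL_chartPoint`, Kerr stabiliser) and, for `a = 0`, for any painting
  frame `Λ·R` with `R e₀ = e₀` (`radius_poincareInv_mul_chartPoint_zero_spin`);
* `boostedKerrBilin_chartPoint_apply` — the hole's own painted summand at `x`, on lab vectors
  `v, v′`, is rest-frame Kerr at `z` on `Λ⁻¹v, Λ⁻¹v′` (stationarity absorbs the time shift of `w`);
* `spatial_eq_of_spatial_apply_purge_eq` — the leg `z̃ ↦ (Λ w)~` is injective.

So `{r = r₊}` of the hole chart is EXACTLY the painted horizon of the lab ansatz, which the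
hypothesis' exhaustion clause already treats as the boundary of the charted exterior.
[folklore linear algebra of `O(1,3)`; Kerr–Schild 1965 (stationarity, axisymmetry)]
-/

noncomputable section

set_option linter.dupNamespace false

open Literature.Geometry.Lorentzian
open Summit.FinalStateConjecture.FinalStateConjecture.Theorems.InertialRecession.Negative

namespace Summit.FinalStateConjecture.FinalStateConjecture.Theorems.SublinearIsFree.Rechart

section Leg

variable (Λ : lorentzGroup) (T : ℝ) (ξ : E3) (z : E4) {w x : E4}
  (hw : w = E4.ofTimeSpace 0 (E4.spatial z) -
    ((((Λ : E4 ≃L[ℝ] E4) (E4.ofTimeSpace 0 (E4.spatial z))) 0) /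
      (((Λ : E4 ≃L[ℝ] E4) (E4.basisVector 0)) 0)) • E4.basisVector 0)
  (hx : x = E4.ofTimeSpace T ξ + (Λ : E4 ≃L[ℝ] E4) w)

/-- The spatial part of the time axis vanishes (bookkeeping). [folklore] -/
theorem spatial_basisVector_zero' : E4.spatial (E4.basisVector 0) = 0 := by
  ext i
  simp [E4.spatial_apply, Fin.succ_ne_zero]

include hw in
/-- **The lab displacement of the time-purged rest vector is purely spatial**: `(Λ w)⁰ = 0`
(the purge subtracts exactly the multiple of `e₀` whose image cancels the time component;
`(Λ e₀)⁰ ≠ 0` since `|(Λ e₀)⁰| ≥ 1`). [folklore] -/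
theorem purge_apply_zero : ((Λ : E4 ≃L[ℝ] E4) w) 0 = 0 := by
  have hγ : ((Λ : E4 ≃L[ℝ] E4) (E4.basisVector 0)) 0 ≠ 0 := fun h ↦ by
    have := one_le_abs_lorentz_apply_zero Λ
    rw [h, abs_zero] at this
    exact absurd this (by norm_num)
  rw [hw, map_sub, map_smul]
  simp only [PiLp.sub_apply, PiLp.smul_apply, smul_eq_mul]
  field_simp
  ring

include hw in
/-- The purge does not change the spatial part: `w̃ = z̃`. [folklore] -/
theorem spatial_purge : E4.spatial w = E4.spatial z := by
  rw [hw, map_sub, map_smul, E4.spatial_ofTimeSpace, spatial_basisVector_zero', smul_zero,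
    sub_zero]

include hw hx in
/-- **The chart point has lab time `T`.** [folklore] -/
theorem chartPoint_apply_zero : x 0 = T := by
  rw [hx, PiLp.add_apply, purge_apply_zero Λ z hw, E4.ofTimeSpace_apply_zero, add_zero]

include hx in
/-- The chart point has lab position `ξ + (Λ w)~`. [folklore] -/
theorem spatial_chartPoint : E4.spatial x = ξ + E4.spatial ((Λ : E4 ≃L[ℝ] E4) w) := by
  rw [hx, map_add, E4.spatial_ofTimeSpace]

include hx in
/-- **The rest-frame position of the chart point is the purged vector itself**:
`Λ⁻¹(x − (T, ξ)) = w`. [folklore] -/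
theorem poincareInv_chartPoint : poincareInv Λ (E4.ofTimeSpace T ξ) x = w := by
  rw [poincareInv, hx, add_sub_cancel_left, ContinuousLinearEquiv.symm_apply_apply]

include hw hx in
/-- **Exact painted-radius identity.** The painted Kerr–Schild radius of the chart point, for the
centre `(T, ξ)` and the frame `Λ`, is the chart radius `r_a(z)` (the radius depends on the spatial
part only, and `w̃ = z̃`). [folklore] -/
theorem radius_poincareInv_chartPoint (a : ℝ) :
    Kerr.radius a (poincareInv Λ (E4.ofTimeSpace T ξ) x) = Kerr.radius a z := by
  rw [poincareInv_chartPoint Λ T ξ hx]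
  exact Kerr.radius_eq_of_spatial_eq a (spatial_purge Λ z hw)

include hw hx in
/-- The painted-radius identity for the TWISTED painting frame `Λ·R_θ` (the Kerr–Schild radius is
axisymmetric, `radius_poincareInv_mul_rotL`): the crux's frame `Λᵢ(t)` and the stabiliser-free
frame `Λ̃ᵢ(t) = Λᵢ(t)·R_{−θ(t)}` paint the same radius. [folklore] -/
theorem radius_poincareInv_mul_rotL_chartPoint (θ a : ℝ) :
    Kerr.radius a (poincareInv (Λ * rotL θ) (E4.ofTimeSpace T ξ) x) = Kerr.radius a z := by
  rw [radius_poincareInv_mul_rotL, radius_poincareInv_chartPoint Λ T ξ z hw hx]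

include hw hx in
/-- The painted-radius identity for a Schwarzschild hole (`a = 0`) and ANY painting frame `Λ·R`
with `R e₀ = e₀` (the full stabiliser: `r₀ = ‖·̃‖` is invariant under Lorentz maps fixing `e₀`).
[folklore] -/
theorem radius_poincareInv_mul_chartPoint_zero_spin {R : lorentzGroup}
    (hR : (R : E4 ≃L[ℝ] E4) (E4.basisVector 0) = E4.basisVector 0) :
    Kerr.radius 0 (poincareInv (Λ * R) (E4.ofTimeSpace T ξ) x) = Kerr.radius 0 z := by
  have h1 : poincareInv (Λ * R) (E4.ofTimeSpace T ξ) x =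
      ((R⁻¹ : lorentzGroup) : E4 ≃L[ℝ] E4) (poincareInv Λ (E4.ofTimeSpace T ξ) x) := by
    rw [poincareInv, poincareInv, lorentz_mul_symm_apply, coe_lorentz_inv]
  rw [h1, Kerr.radius_zero_left, Kerr.radius_zero_left,
    spatialNorm_eq_of_apply_basisVector_zero (symm_apply_basisVector_zero_of_apply hR),
    ← Kerr.radius_zero_left, ← Kerr.radius_zero_left,
    radius_poincareInv_chartPoint Λ T ξ z hw hx]

include hw hx in
/-- **The own painted summand at the chart point is rest-frame Kerr at `z`** on the pulled-back
vectors: `boostedKerrBilin Λ (T, ξ) M a x v v′ = g_{M,a}(z)(Λ⁻¹ v, Λ⁻¹ v′)` — the rest-frame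
position is `w`, which has the spatial part of `z`, and the Kerr–Schild form is stationary
(`kerr_bilin_eq_of_spatial_eq`). Kerr–Schild 1965, §2. [folklore] -/
theorem boostedKerrBilin_chartPoint_apply (M a : ℝ) (v v' : E4) :
    boostedKerrBilin Λ (E4.ofTimeSpace T ξ) M a x v v' =
      Kerr.bilin M a z ((Λ : E4 ≃L[ℝ] E4).symm v) ((Λ : E4 ≃L[ℝ] E4).symm v') := by
  rw [boostedKerrBilin_apply, poincareInv_chartPoint Λ T ξ hx,
    kerr_bilin_eq_of_spatial_eq M a (spatial_purge Λ z hw)]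

include hw hx in
/-- The same for the twisted painting frame `Λ·R_θ` (`boostedKerrBilin_mul_rotL`). [folklore] -/
theorem boostedKerrBilin_mul_rotL_chartPoint_apply (θ M a : ℝ) (v v' : E4) :
    boostedKerrBilin (Λ * rotL θ) (E4.ofTimeSpace T ξ) M a x v v' =
      Kerr.bilin M a z ((Λ : E4 ≃L[ℝ] E4).symm v) ((Λ : E4 ≃L[ℝ] E4).symm v') := by
  rw [boostedKerrBilin_mul_rotL, boostedKerrBilin_chartPoint_apply Λ T ξ z hw hx]

end Leg

/-- **The spatial leg is injective**: if two purged vectors have lab displacements with the same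
spatial part then the rest points have the same spatial part (both displacements are purely
spatial, so they are equal, so the purged vectors are equal, and `w̃ = z̃`). [folklore] -/
theorem spatial_eq_of_spatial_apply_purge_eq (Λ : lorentzGroup) (z₁ z₂ : E4) {w₁ w₂ : E4}
    (hw₁ : w₁ = E4.ofTimeSpace 0 (E4.spatial z₁) -
      ((((Λ : E4 ≃L[ℝ] E4) (E4.ofTimeSpace 0 (E4.spatial z₁))) 0) /
        (((Λ : E4 ≃L[ℝ] E4) (E4.basisVector 0)) 0)) • E4.basisVector 0)
    (hw₂ : w₂ = E4.ofTimeSpace 0 (E4.spatial z₂) -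
      ((((Λ : E4 ≃L[ℝ] E4) (E4.ofTimeSpace 0 (E4.spatial z₂))) 0) /
        (((Λ : E4 ≃L[ℝ] E4) (E4.basisVector 0)) 0)) • E4.basisVector 0)
    (h : E4.spatial ((Λ : E4 ≃L[ℝ] E4) w₁) = E4.spatial ((Λ : E4 ≃L[ℝ] E4) w₂)) :
    E4.spatial z₁ = E4.spatial z₂ := by
  have h0 : ((Λ : E4 ≃L[ℝ] E4) w₁) 0 = ((Λ : E4 ≃L[ℝ] E4) w₂) 0 := by
    rw [purge_apply_zero Λ z₁ hw₁, purge_apply_zero Λ z₂ hw₂]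
  have hΛ : (Λ : E4 ≃L[ℝ] E4) w₁ = (Λ : E4 ≃L[ℝ] E4) w₂ := by
    rw [← E4.ofTimeSpace_time_spatial ((Λ : E4 ≃L[ℝ] E4) w₁),
      ← E4.ofTimeSpace_time_spatial ((Λ : E4 ≃L[ℝ] E4) w₂), E4.time_apply, E4.time_apply, h0, h]
  have hww : w₁ = w₂ := (Λ : E4 ≃L[ℝ] E4).injective hΛ
  rw [← spatial_purge Λ z₁ hw₁, ← spatial_purge Λ z₂ hw₂, hww]

/-- **Distinct chart points on one lab slab.** Two chart points built at the same lab time `T`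
over the same centre and frame coincide only if the rest points have the same spatial part:
`(T, ξ) + Λ w₁ = (T, ξ) + Λ w₂ → z̃₁ = z̃₂` (the step `x¹ = x² ⇒ S(T)z̲₁ = S(T)z̲₂ ⇒ z̲₁ = z̲₂` of
the injectivity proof of the hole chart; the remaining step `T₁ = T₂ ⇒ τ₁ = τ₂` is the strict
monotonicity of `τ ↦ T₀(τ) + ℓ(T₀ τ)·z̲`). [folklore] -/
theorem spatial_eq_of_chartPoint_eq (Λ : lorentzGroup) (T : ℝ) (ξ : E3) (z₁ z₂ : E4)
    {w₁ w₂ : E4}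
    (hw₁ : w₁ = E4.ofTimeSpace 0 (E4.spatial z₁) -
      ((((Λ : E4 ≃L[ℝ] E4) (E4.ofTimeSpace 0 (E4.spatial z₁))) 0) /
        (((Λ : E4 ≃L[ℝ] E4) (E4.basisVector 0)) 0)) • E4.basisVector 0)
    (hw₂ : w₂ = E4.ofTimeSpace 0 (E4.spatial z₂) -
      ((((Λ : E4 ≃L[ℝ] E4) (E4.ofTimeSpace 0 (E4.spatial z₂))) 0) /
        (((Λ : E4 ≃L[ℝ] E4) (E4.basisVector 0)) 0)) • E4.basisVector 0)
    (h : E4.ofTimeSpace T ξ + (Λ : E4 ≃L[ℝ] E4) w₁ = E4.ofTimeSpace T ξ + (Λ : E4 ≃L[ℝ] E4) w₂) :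
    E4.spatial z₁ = E4.spatial z₂ :=
  spatial_eq_of_spatial_apply_purge_eq Λ z₁ z₂ hw₁ hw₂ (by rw [add_right_injective _ h])

/-- Registered sub-goal form (stub `chartPoint_keyProperty` of the crux item): for the time-purged
rest vector `w` of `z` and the chart point `x = (T, ξ) + Λ w` — the lab displacement is spatial,
the painted radius is the chart radius, and the own painted summand is rest-frame Kerr at `z`.
[folklore] -/
theorem chartPoint_keyProperty : open Literature.Geometry.Lorentzian in ∀ (Λ : lorentzGroup) (T : ℝ) (ξ : E3) (z : E4) (M a : ℝ) (v v' : E4), (((Λ : E4 ≃L[ℝ] E4) (E4.ofTimeSpace 0 (E4.spatial z) - ((((Λ : E4 ≃L[ℝ] E4) (E4.ofTimeSpace 0 (E4.spatial z))) 0) / (((Λ : E4 ≃L[ℝ] E4) (E4.basisVector 0)) 0)) • E4.basisVector 0)) 0 = 0) ∧ Kerr.radius a (poincareInv Λ (E4.ofTimeSpace T ξ) (E4.ofTimeSpace T ξ + (Λ : E4 ≃L[ℝ] E4) (E4.ofTimeSpace 0 (E4.spatial z) - ((((Λ : E4 ≃L[ℝ] E4) (E4.ofTimeSpace 0 (E4.spatial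 z))) 0) / (((Λ : E4 ≃L[ℝ] E4) (E4.basisVector 0)) 0)) • E4.basisVector 0))) = Kerr.radius a z ∧ boostedKerrBilin Λ (E4.ofTimeSpace T ξ) M a (E4.ofTimeSpace T ξ + (Λ : E4 ≃L[ℝ] E4) (E4.ofTimeSpace 0 (E4.spatial z) - ((((Λ : E4 ≃L[ℝ] E4) (E4.ofTimeSpace 0 (E4.spatial z))) 0) / (((Λ : E4 ≃L[ℝ] E4) (E4.basisVector 0)) 0)) • E4.basisVector 0)) v v' = Kerr.bilin M a z ((Λ : E4 ≃L[ℝ] E4).symm v) ((Λ : E4 ≃L[ℝ] E4).symm v') :=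
  fun Λ T ξ z M a v v' ↦ ⟨purge_apply_zero Λ z rfl, radius_poincareInv_chartPoint Λ T ξ z rfl rfl a,
    boostedKerrBilin_chartPoint_apply Λ T ξ z rfl rfl M a v v'⟩

end Summit.FinalStateConjecture.FinalStateConjecture.Theorems.SublinearIsFree.Rechart

end
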